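import Summits.QuantumFields.YangMills.Theorems.PoincareLipschitzQuaternionCurrents
import HarnessLib

/-!
# Crux `BlockLipschitzL` (stmt-QuantumFields-23533) ∕ `HistoryTailL` (stmt-QuantumFields-19936), LINE 25 «CompactnessTransfer»,
# the (TM) road, ROAD (H) «SU(2) CURRENTS ⇒ H-SYSTEM ⇒ 8π QUANTUM» — brick (Q), FILE 2 «FLATNESS (MAURER–CARTAN) AND THE H-SYSTEM ROWS»

Cell `ym3-torus` (YM ladder rung R3 = continuum SU(2) Yang–Mills on T³ — a RUNG, NOT Clay: not d = 4, not infinite volume,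
not a mass gap); WIDTH helper seat `ym3-torus-px19` g8 (road memo `ROAD-TM-HSYSTEM-px19g8.md`, 23533 evidence); `--supports
stmt-QuantumFields-23533`; THEOREMS ONLY (0 `def`, 0 `sorry`, default heartbeats); imports FILE 1 ✓`…PoincareLipschitzQuaternionCurrents`
(letters, tangency, the `ring` identities, (Q1), (Q2)) and through it ✓(Q-J) `…PoincareLipschitzWeakJacobianIdentity.integral_mul_jacobian`.

WHAT THIS FILE PROVES, for a unit map `w : ℝ² → S³ ⊂ ℝ⁴` with weak gradient `Gw` on `ℝ²` and finite energy, sphere currents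
`j_{mn,k} = w_m (Gw e_k)_n − w_n (Gw e_k)_m` and left currents `A⁰ = j₀₁ − j₂₃`, `A¹ = j₀₂ − j₃₁`, `A² = j₀₃ − j₁₂` (hypothesis-pinned
`J`, `A`):
* §6 `locallyIntegrableOn_coord_sq`, `norm_proj_comp_sq_le`, `locallyIntegrableOn_coordGrad_sq`, `integral_coord_jacobian`
  (✓`integral_mul_jacobian` at two coordinates of `w`), ★ `sphereCurrent_curl` (`∫ (j_{mn,1} ∂₀η − j_{mn,0} ∂₁η) = −2 ∫ η D_{mn}`),
  ★★ `leftCurrents_flat` — (Q3) FLATNESS IN `D′(ℝ²)`: `∫ (A^a₁ ∂₀η − A^a₀ ∂₁η) = 2 ∫ η (A^b₀ A^c₁ − A^c₀ A^b₁)`, `(a,b,c)` cyclic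
  (`∂₀A₁ − ∂₁A₀ = −2 A₀ × A₁` weakly: the Maurer–Cartan equation of `A = w̄ dw`);
* §7 ★★★ `hSystem_rows` — (Q4): if `GB e₀ = (−A^a₁)_a`, `GB e₁ = (A^a₀)_a` (planar stream functions, brick (H)) then
  `−∫ Σ_k ∂_kη (GB e_k)_a = 2 ∫ η ((GB e₀)_{a+1} (GB e₁)_{a+2} − (GB e₀)_{a+2} (GB e₁)_{a+1})` for all test `η` and `a : Fin 3` — the
  hypothesis row of the named fact `HSystemEnergyQuantization` [BrezisCoron1985, Lemma A.1 (A.1)] TOKEN FOR TOKEN — and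
  ★★ `streamFunctions_energy`: `Σ_k ‖GB e_k‖² = Σ_k ‖Gw e_k‖²` a.e., integrable, `∫ Σ_k‖GB e_k‖² = ∫ |∇w|²`.
So `B` is a finite-energy `W^{1,2}_loc` weak solution of the H-SYSTEM `ΔB = 2 B_x ∧ B_y` with the Dirichlet energy of `w`.
Signs were checked numerically before typing; here the kernel checks them (`ring` on the pointwise identities of FILE 1).
HONEST SCOPE.  Sobolev∕quaternion calculus; nothing of (GAP)∕(TM), (C), S1″, K1, `MeanDeviationL`, `BlockLipschitzL`,
`HistoryTailL` is proved here.  YM₃ on T³ is rung R3, not Clay; YM gap NOT proved; no summit statement is proved here.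

References: F. Hélein (2002) [Helein2002] (§1.4, §3.1); H. Brezis, J.-M. Coron, Arch. Rational Mech. Anal. 89 (1985)
[BrezisCoron1985] (Appendix, Lemma A.1).
-/

set_option autoImplicit false

noncomputable section

open MeasureTheory Set Function Filter Topology Metric TopologicalSpace
open scoped ContDiff ENNReal BigOperators RealInnerProductSpace

namespace Summit.QuantumFields.YangMills.Theorems.PoincareLipschitzQuaternionCurrentsHSystem

open Literature.Analysis.FunctionSpaces
open Summit.QuantumFields.YangMills.Theorems.PoincareLipschitzWeakJacobianIdentity (integral_mul_jacobian integrable_mul_of_L2)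
open Summit.QuantumFields.YangMills.Theorems.PoincareLipschitzWeakChainRuleShear (integrableOn_smul_of_locallyIntegrableOn)
open Summit.QuantumFields.YangMills.Theorems.PoincareLipschitzQuaternionCurrents

section Plane

variable {w : EuclideanSpace ℝ (Fin 2) → EuclideanSpace ℝ (Fin 4)}
  {Gw : EuclideanSpace ℝ (Fin 2) → EuclideanSpace ℝ (Fin 2) →L[ℝ] EuclideanSpace ℝ (Fin 4)}

/-! ## §6 (Q3) Flatness (Maurer–Cartan) in `D′(ℝ²)` -/

/-- Local square-integrability letters for the coordinates, feeding ✓`integral_mul_jacobian`. [folklore] -/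
theorem locallyIntegrableOn_coord_sq (hw : HasWeakFDerivOn ⟨Set.univ, isOpen_univ⟩ volume w Gw) (hw1 : ∀ y, ‖w y‖ = 1)
    (m : Fin 4) : LocallyIntegrableOn (fun y => (w y m) ^ 2) (Set.univ : Set (EuclideanSpace ℝ (Fin 2))) volume := by
  refine ((locallyIntegrable_const (1:ℝ)).mono ?_ (Filter.Eventually.of_forall fun y => ?_)).locallyIntegrableOn _
  · exact ((EuclideanSpace.proj m : EuclideanSpace ℝ (Fin 4) →L[ℝ] ℝ).continuous.comp_aestronglyMeasurable
      (aestronglyMeasurable_of_sobolev hw)).pow 2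
  · have h : ‖w y m‖ ≤ 1 := by simpa [hw1 y] using PiLp.norm_apply_le (w y) m
    rw [norm_pow, norm_one]
    exact pow_le_one₀ (norm_nonneg _) h

/-- `‖proj_m ∘ T‖² ≤ 2 Σ_k ‖T e_k‖²` on `ℝ²`. [folklore] -/
theorem norm_proj_comp_sq_le (T : EuclideanSpace ℝ (Fin 2) →L[ℝ] EuclideanSpace ℝ (Fin 4)) (m : Fin 4) :
    ‖(EuclideanSpace.proj m : EuclideanSpace ℝ (Fin 4) →L[ℝ] ℝ).comp T‖ ^ 2 ≤
      2 * ∑ k : Fin 2, ‖T (EuclideanSpace.single k (1:ℝ))‖ ^ 2 := by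
  have h1 : ‖(EuclideanSpace.proj m : EuclideanSpace ℝ (Fin 4) →L[ℝ] ℝ).comp T‖ ≤ ‖T‖ := by
    refine ContinuousLinearMap.opNorm_le_bound _ (norm_nonneg _) fun v => ?_
    rw [ContinuousLinearMap.comp_apply]
    have := PiLp.norm_apply_le (T v) m
    simpa using this.trans (ContinuousLinearMap.le_opNorm _ _)
  have h2 := opNorm_le_sum_two T
  rw [Fin.sum_univ_two] at h2 ⊢
  have ha0 : 0 ≤ ‖(EuclideanSpace.proj m : EuclideanSpace ℝ (Fin 4) →L[ℝ] ℝ).comp T‖ := norm_nonneg _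
  have hb0 : 0 ≤ ‖T (EuclideanSpace.single 0 (1:ℝ))‖ := norm_nonneg _
  have hb1 : 0 ≤ ‖T (EuclideanSpace.single 1 (1:ℝ))‖ := norm_nonneg _
  have hab := h1.trans h2
  nlinarith [mul_le_mul hab hab ha0 (hb0.trans (le_add_of_nonneg_right hb1)),
    sq_nonneg (‖T (EuclideanSpace.single 0 (1:ℝ))‖ - ‖T (EuclideanSpace.single 1 (1:ℝ))‖)]

/-- The coordinate rows `proj_m ∘ Gw` have locally square-integrable operator norm. [folklore] -/
theorem locallyIntegrableOn_coordGrad_sq (hw : HasWeakFDerivOn ⟨Set.univ, isOpen_univ⟩ volume w Gw)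
    (hE : Integrable (fun y => ∑ k : Fin 2, ‖Gw y (EuclideanSpace.single k (1:ℝ))‖ ^ 2) volume) (m : Fin 4) :
    LocallyIntegrableOn (fun y => ‖(EuclideanSpace.proj m : EuclideanSpace ℝ (Fin 4) →L[ℝ] ℝ).comp (Gw y)‖ ^ 2)
      (Set.univ : Set (EuclideanSpace ℝ (Fin 2))) volume := by
  have hm : AEStronglyMeasurable (fun y => (EuclideanSpace.proj m : EuclideanSpace ℝ (Fin 4) →L[ℝ] ℝ).comp (Gw y)) volume := by
    have := (hasWeakFDerivOn_coord hw m).locallyIntegrableOn_deriv.aestronglyMeasurable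
    simpa only [TopologicalSpace.Opens.coe_mk, Measure.restrict_univ] using this
  have hm2 : AEStronglyMeasurable
      (fun y => ‖(EuclideanSpace.proj m : EuclideanSpace ℝ (Fin 4) →L[ℝ] ℝ).comp (Gw y)‖ ^ 2) volume := by
    have := (continuous_pow 2).comp_aestronglyMeasurable hm.norm
    simpa [Function.comp_def] using this
  refine (((hE.const_mul 2).mono' hm2 (Filter.Eventually.of_forall fun y => ?_)).locallyIntegrable).locallyIntegrableOn _
  rw [Real.norm_eq_abs, abs_of_nonneg (sq_nonneg _)]
  exact norm_proj_comp_sq_le (Gw y) m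

/-- The weak Jacobian identity for two coordinates of `w`:
`∫ w_m ((∂₁w)_n ∂₀η − (∂₀w)_n ∂₁η) = ∫ η ((∂₁w)_m (∂₀w)_n − (∂₀w)_m (∂₁w)_n)`. [cite: Helein2002, §3.1] -/
theorem integral_coord_jacobian (hw : HasWeakFDerivOn ⟨Set.univ, isOpen_univ⟩ volume w Gw) (hw1 : ∀ y, ‖w y‖ = 1)
    (hE : Integrable (fun y => ∑ k : Fin 2, ‖Gw y (EuclideanSpace.single k (1:ℝ))‖ ^ 2) volume) (m n : Fin 4)
    {η : EuclideanSpace ℝ (Fin 2) → ℝ} (hη : ContDiff ℝ ∞ η) (hηc : HasCompactSupport η) :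
    ∫ y, w y m * (Gw y (EuclideanSpace.single 1 (1:ℝ)) n * fderiv ℝ η y (EuclideanSpace.single 0 (1:ℝ)) -
        Gw y (EuclideanSpace.single 0 (1:ℝ)) n * fderiv ℝ η y (EuclideanSpace.single 1 (1:ℝ))) =
      ∫ y, η y * (Gw y (EuclideanSpace.single 1 (1:ℝ)) m * Gw y (EuclideanSpace.single 0 (1:ℝ)) n -
        Gw y (EuclideanSpace.single 0 (1:ℝ)) m * Gw y (EuclideanSpace.single 1 (1:ℝ)) n) := by
  have hη' : IsTestFunctionOn (⟨Set.univ, isOpen_univ⟩ : Opens (EuclideanSpace ℝ (Fin 2))) η :=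
    ⟨hη, hηc, Set.subset_univ _⟩
  have h := integral_mul_jacobian (μ := volume) (hasWeakFDerivOn_coord hw m) (hasWeakFDerivOn_coord hw n)
    (locallyIntegrableOn_coord_sq hw hw1 m) (locallyIntegrableOn_coord_sq hw hw1 n)
    (locallyIntegrableOn_coordGrad_sq hw hE m) (locallyIntegrableOn_coordGrad_sq hw hE n) hη'
    (EuclideanSpace.single 0 (1:ℝ)) (EuclideanSpace.single 1 (1:ℝ))
  simpa only [TopologicalSpace.Opens.coe_mk, Measure.restrict_univ, ContinuousLinearMap.comp_apply, PiLp.proj_apply] using h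

/-- **The sphere current `jₘₙ` tested against `curl`**: `∫ (jₘₙ,₁ ∂₀η − jₘₙ,₀ ∂₁η) = −2 ∫ η ((∂₀w)_m (∂₁w)_n − (∂₀w)_n (∂₁w)_m)`
(twice the `(m,n)` minor of `(∂₀w | ∂₁w)`). [cite: Helein2002, §3.1] -/
theorem sphereCurrent_curl (hw : HasWeakFDerivOn ⟨Set.univ, isOpen_univ⟩ volume w Gw) (hw1 : ∀ y, ‖w y‖ = 1)
    (hE : Integrable (fun y => ∑ k : Fin 2, ‖Gw y (EuclideanSpace.single k (1:ℝ))‖ ^ 2) volume)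
    {J : Fin 4 → Fin 4 → EuclideanSpace ℝ (Fin 2) → Fin 2 → ℝ}
    (hJ : ∀ m n y k, J m n y k = w y m * Gw y (EuclideanSpace.single k (1:ℝ)) n - w y n * Gw y (EuclideanSpace.single k (1:ℝ)) m)
    (m n : Fin 4) {η : EuclideanSpace ℝ (Fin 2) → ℝ} (hη : ContDiff ℝ ∞ η) (hηc : HasCompactSupport η) :
    ∫ y, (J m n y 1 * fderiv ℝ η y (EuclideanSpace.single 0 (1:ℝ)) - J m n y 0 * fderiv ℝ η y (EuclideanSpace.single 1 (1:ℝ))) =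
      -2 * ∫ y, η y * (Gw y (EuclideanSpace.single 0 (1:ℝ)) m * Gw y (EuclideanSpace.single 1 (1:ℝ)) n -
        Gw y (EuclideanSpace.single 0 (1:ℝ)) n * Gw y (EuclideanSpace.single 1 (1:ℝ)) m) := by
  have Xmn := integral_coord_jacobian hw hw1 hE m n hη hηc
  have Xnm := integral_coord_jacobian hw hw1 hE n m hη hηc
  -- integrability of the two halves
  have hI : ∀ m n : Fin 4, Integrable (fun y => w y m * (Gw y (EuclideanSpace.single 1 (1:ℝ)) n *
      fderiv ℝ η y (EuclideanSpace.single 0 (1:ℝ)) - Gw y (EuclideanSpace.single 0 (1:ℝ)) n *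
      fderiv ℝ η y (EuclideanSpace.single 1 (1:ℝ)))) volume := by
    intro m n
    have h := (integrable_fderiv_mul_coord_mul_grad hw hw1 hη hηc 1 0 m n).sub
      (integrable_fderiv_mul_coord_mul_grad hw hw1 hη hηc 0 1 m n)
    refine h.congr (Filter.Eventually.of_forall fun y => ?_)
    simp only [Pi.sub_apply]
    ring
  have hI' : ∀ m n : Fin 4, Integrable (fun y => η y * (Gw y (EuclideanSpace.single 1 (1:ℝ)) m *
      Gw y (EuclideanSpace.single 0 (1:ℝ)) n - Gw y (EuclideanSpace.single 0 (1:ℝ)) m *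
      Gw y (EuclideanSpace.single 1 (1:ℝ)) n)) volume := by
    intro m n
    have h := (integrable_mul_grad_grad hw hE hη hηc 1 0 m n).sub (integrable_mul_grad_grad hw hE hη hηc 0 1 m n)
    refine h.congr (Filter.Eventually.of_forall fun y => ?_)
    simp only [Pi.sub_apply]
    ring
  have hL : ∫ y, (J m n y 1 * fderiv ℝ η y (EuclideanSpace.single 0 (1:ℝ)) - J m n y 0 * fderiv ℝ η y (EuclideanSpace.single 1 (1:ℝ))) =
      (∫ y, w y m * (Gw y (EuclideanSpace.single 1 (1:ℝ)) n * fderiv ℝ η y (EuclideanSpace.single 0 (1:ℝ)) -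
        Gw y (EuclideanSpace.single 0 (1:ℝ)) n * fderiv ℝ η y (EuclideanSpace.single 1 (1:ℝ)))) -
      ∫ y, w y n * (Gw y (EuclideanSpace.single 1 (1:ℝ)) m * fderiv ℝ η y (EuclideanSpace.single 0 (1:ℝ)) -
        Gw y (EuclideanSpace.single 0 (1:ℝ)) m * fderiv ℝ η y (EuclideanSpace.single 1 (1:ℝ))) := by
    rw [← integral_sub (hI m n) (hI n m)]
    refine integral_congr_ae (Filter.Eventually.of_forall fun y => ?_)
    simp only [hJ]
    ring
  rw [hL, Xmn, Xnm, ← integral_sub (hI' m n) (hI' n m), ← integral_const_mul]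
  refine integral_congr_ae (Filter.Eventually.of_forall fun y => ?_)
  ring

/-- ★★ **(Q3) FLATNESS OF THE LEFT CURRENTS IN `D′(ℝ²)` (MAURER–CARTAN)**: for `(a, b, c)` a cyclic permutation of `(0, 1, 2)`,
`∫ (A^a₁ ∂₀η − A^a₀ ∂₁η) = 2 ∫ η (A^b₀ A^c₁ − A^c₀ A^b₁)` — i.e. `∂₀A^a₁ − ∂₁A^a₀ = −2 (A₀ × A₁)_a` weakly. ✓`sphereCurrent_curl`
for the two pairs of each current plus the pointwise identity ✓`maurerCartan_pointwise_·` at `|w| = 1`, `w ⊥ ∂_k w` a.e.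
[folklore] -/
theorem leftCurrents_flat (hw : HasWeakFDerivOn ⟨Set.univ, isOpen_univ⟩ volume w Gw) (hw1 : ∀ y, ‖w y‖ = 1)
    (hE : Integrable (fun y => ∑ k : Fin 2, ‖Gw y (EuclideanSpace.single k (1:ℝ))‖ ^ 2) volume)
    {J : Fin 4 → Fin 4 → EuclideanSpace ℝ (Fin 2) → Fin 2 → ℝ}
    (hJ : ∀ m n y k, J m n y k = w y m * Gw y (EuclideanSpace.single k (1:ℝ)) n - w y n * Gw y (EuclideanSpace.single k (1:ℝ)) m)
    {A : Fin 3 → EuclideanSpace ℝ (Fin 2) → Fin 2 → ℝ}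
    (hA : ∀ y k, A 0 y k = J 0 1 y k - J 2 3 y k ∧ A 1 y k = J 0 2 y k - J 3 1 y k ∧ A 2 y k = J 0 3 y k - J 1 2 y k)
    {η : EuclideanSpace ℝ (Fin 2) → ℝ} (hη : ContDiff ℝ ∞ η) (hηc : HasCompactSupport η) :
    (∫ y, (A 0 y 1 * fderiv ℝ η y (EuclideanSpace.single 0 (1:ℝ)) - A 0 y 0 * fderiv ℝ η y (EuclideanSpace.single 1 (1:ℝ))) =
        2 * ∫ y, η y * (A 1 y 0 * A 2 y 1 - A 2 y 0 * A 1 y 1)) ∧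
      (∫ y, (A 1 y 1 * fderiv ℝ η y (EuclideanSpace.single 0 (1:ℝ)) - A 1 y 0 * fderiv ℝ η y (EuclideanSpace.single 1 (1:ℝ))) =
        2 * ∫ y, η y * (A 2 y 0 * A 0 y 1 - A 0 y 0 * A 2 y 1)) ∧
      (∫ y, (A 2 y 1 * fderiv ℝ η y (EuclideanSpace.single 0 (1:ℝ)) - A 2 y 0 * fderiv ℝ η y (EuclideanSpace.single 1 (1:ℝ))) =
        2 * ∫ y, η y * (A 0 y 0 * A 1 y 1 - A 1 y 0 * A 0 y 1)) := by
  -- shorthand: the minors and the currents at a point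
  have P := fun m n => sphereCurrent_curl hw hw1 hE hJ m n hη hηc
  have htan := inner_weakGrad_eq_zero_ae hw (fun y _ => hw1 y)
  simp only [TopologicalSpace.Opens.coe_mk, Measure.restrict_univ] at htan
  -- integrability of `J_{mn,1} ∂₀η − J_{mn,0} ∂₁η`
  have hI : ∀ m n : Fin 4, Integrable (fun y => J m n y 1 * fderiv ℝ η y (EuclideanSpace.single 0 (1:ℝ)) -
      J m n y 0 * fderiv ℝ η y (EuclideanSpace.single 1 (1:ℝ))) volume := by
    intro m n
    have h := ((integrable_fderiv_mul_coord_mul_grad hw hw1 hη hηc 1 0 m n).sub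
      (integrable_fderiv_mul_coord_mul_grad hw hw1 hη hηc 1 0 n m)).sub
      ((integrable_fderiv_mul_coord_mul_grad hw hw1 hη hηc 0 1 m n).sub
      (integrable_fderiv_mul_coord_mul_grad hw hw1 hη hηc 0 1 n m))
    refine h.congr (Filter.Eventually.of_forall fun y => ?_)
    simp only [Pi.sub_apply, hJ]
    ring
  -- integrability of `η · minor`
  have hD : ∀ m n : Fin 4, Integrable (fun y => η y * (Gw y (EuclideanSpace.single 0 (1:ℝ)) m *
      Gw y (EuclideanSpace.single 1 (1:ℝ)) n - Gw y (EuclideanSpace.single 0 (1:ℝ)) n *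
      Gw y (EuclideanSpace.single 1 (1:ℝ)) m)) volume := by
    intro m n
    have h := (integrable_mul_grad_grad hw hE hη hηc 0 1 m n).sub (integrable_mul_grad_grad hw hE hη hηc 0 1 n m)
    refine h.congr (Filter.Eventually.of_forall fun y => ?_)
    simp only [Pi.sub_apply]
    ring
  -- the pointwise Maurer–Cartan identities, a.e., as a.e. equalities of the `η`-weighted integrands
  have hMC : ∀ᵐ y,
      η y * ((Gw y (EuclideanSpace.single 0 (1:ℝ)) 0 * Gw y (EuclideanSpace.single 1 (1:ℝ)) 1 -
          Gw y (EuclideanSpace.single 0 (1:ℝ)) 1 * Gw y (EuclideanSpace.single 1 (1:ℝ)) 0) -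
        (Gw y (EuclideanSpace.single 0 (1:ℝ)) 2 * Gw y (EuclideanSpace.single 1 (1:ℝ)) 3 -
          Gw y (EuclideanSpace.single 0 (1:ℝ)) 3 * Gw y (EuclideanSpace.single 1 (1:ℝ)) 2)) =
        -(η y * (A 1 y 0 * A 2 y 1 - A 2 y 0 * A 1 y 1)) ∧
      η y * ((Gw y (EuclideanSpace.single 0 (1:ℝ)) 0 * Gw y (EuclideanSpace.single 1 (1:ℝ)) 2 -
          Gw y (EuclideanSpace.single 0 (1:ℝ)) 2 * Gw y (EuclideanSpace.single 1 (1:ℝ)) 0) -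
        (Gw y (EuclideanSpace.single 0 (1:ℝ)) 3 * Gw y (EuclideanSpace.single 1 (1:ℝ)) 1 -
          Gw y (EuclideanSpace.single 0 (1:ℝ)) 1 * Gw y (EuclideanSpace.single 1 (1:ℝ)) 3)) =
        -(η y * (A 2 y 0 * A 0 y 1 - A 0 y 0 * A 2 y 1)) ∧
      η y * ((Gw y (EuclideanSpace.single 0 (1:ℝ)) 0 * Gw y (EuclideanSpace.single 1 (1:ℝ)) 3 -
          Gw y (EuclideanSpace.single 0 (1:ℝ)) 3 * Gw y (EuclideanSpace.single 1 (1:ℝ)) 0) -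
        (Gw y (EuclideanSpace.single 0 (1:ℝ)) 1 * Gw y (EuclideanSpace.single 1 (1:ℝ)) 2 -
          Gw y (EuclideanSpace.single 0 (1:ℝ)) 2 * Gw y (EuclideanSpace.single 1 (1:ℝ)) 1)) =
        -(η y * (A 0 y 0 * A 1 y 1 - A 1 y 0 * A 0 y 1)) := by
    filter_upwards [htan] with y hy
    have hunit := norm_sq_eq_sum_four (w y)
    rw [hw1 y, one_pow] at hunit
    have ht0 := hy (EuclideanSpace.single 0 (1:ℝ))
    have ht1 := hy (EuclideanSpace.single 1 (1:ℝ))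
    rw [inner_eq_sum_four] at ht0 ht1
    have M0 := maurerCartan_pointwise_0 (w y 0) (w y 1) (w y 2) (w y 3)
      (Gw y (EuclideanSpace.single 0 (1:ℝ)) 0) (Gw y (EuclideanSpace.single 0 (1:ℝ)) 1)
      (Gw y (EuclideanSpace.single 0 (1:ℝ)) 2) (Gw y (EuclideanSpace.single 0 (1:ℝ)) 3)
      (Gw y (EuclideanSpace.single 1 (1:ℝ)) 0) (Gw y (EuclideanSpace.single 1 (1:ℝ)) 1)
      (Gw y (EuclideanSpace.single 1 (1:ℝ)) 2) (Gw y (EuclideanSpace.single 1 (1:ℝ)) 3)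
    have M1 := maurerCartan_pointwise_1 (w y 0) (w y 1) (w y 2) (w y 3)
      (Gw y (EuclideanSpace.single 0 (1:ℝ)) 0) (Gw y (EuclideanSpace.single 0 (1:ℝ)) 1)
      (Gw y (EuclideanSpace.single 0 (1:ℝ)) 2) (Gw y (EuclideanSpace.single 0 (1:ℝ)) 3)
      (Gw y (EuclideanSpace.single 1 (1:ℝ)) 0) (Gw y (EuclideanSpace.single 1 (1:ℝ)) 1)
      (Gw y (EuclideanSpace.single 1 (1:ℝ)) 2) (Gw y (EuclideanSpace.single 1 (1:ℝ)) 3)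
    have M2 := maurerCartan_pointwise_2 (w y 0) (w y 1) (w y 2) (w y 3)
      (Gw y (EuclideanSpace.single 0 (1:ℝ)) 0) (Gw y (EuclideanSpace.single 0 (1:ℝ)) 1)
      (Gw y (EuclideanSpace.single 0 (1:ℝ)) 2) (Gw y (EuclideanSpace.single 0 (1:ℝ)) 3)
      (Gw y (EuclideanSpace.single 1 (1:ℝ)) 0) (Gw y (EuclideanSpace.single 1 (1:ℝ)) 1)
      (Gw y (EuclideanSpace.single 1 (1:ℝ)) 2) (Gw y (EuclideanSpace.single 1 (1:ℝ)) 3)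
    rw [← hunit, one_mul, ht0, ht1, zero_mul, zero_mul, add_zero, sub_zero] at M0 M1 M2
    simp only [(hA y 0).1, (hA y 0).2.1, (hA y 0).2.2, (hA y 1).1, (hA y 1).2.1, (hA y 1).2.2, hJ]
    exact ⟨by linear_combination η y * M0, by linear_combination η y * M1, by linear_combination η y * M2⟩
  -- assemble: each left current is a difference of two sphere currents
  have hsplit : ∀ (m n m' n' : Fin 4) (a : Fin 3), (∀ y k, A a y k = J m n y k - J m' n' y k) →
      ∫ y, (A a y 1 * fderiv ℝ η y (EuclideanSpace.single 0 (1:ℝ)) - A a y 0 * fderiv ℝ η y (EuclideanSpace.single 1 (1:ℝ))) =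
        -2 * ∫ y, (η y * (Gw y (EuclideanSpace.single 0 (1:ℝ)) m * Gw y (EuclideanSpace.single 1 (1:ℝ)) n -
          Gw y (EuclideanSpace.single 0 (1:ℝ)) n * Gw y (EuclideanSpace.single 1 (1:ℝ)) m) -
          η y * (Gw y (EuclideanSpace.single 0 (1:ℝ)) m' * Gw y (EuclideanSpace.single 1 (1:ℝ)) n' -
          Gw y (EuclideanSpace.single 0 (1:ℝ)) n' * Gw y (EuclideanSpace.single 1 (1:ℝ)) m')) := by
    intro m n m' n' a hAa
    have h1 : ∫ y, (A a y 1 * fderiv ℝ η y (EuclideanSpace.single 0 (1:ℝ)) - A a y 0 * fderiv ℝ η y (EuclideanSpace.single 1 (1:ℝ))) =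
        (∫ y, (J m n y 1 * fderiv ℝ η y (EuclideanSpace.single 0 (1:ℝ)) - J m n y 0 * fderiv ℝ η y (EuclideanSpace.single 1 (1:ℝ)))) -
        ∫ y, (J m' n' y 1 * fderiv ℝ η y (EuclideanSpace.single 0 (1:ℝ)) - J m' n' y 0 * fderiv ℝ η y (EuclideanSpace.single 1 (1:ℝ))) := by
      rw [← integral_sub (hI m n) (hI m' n')]
      refine integral_congr_ae (Filter.Eventually.of_forall fun y => ?_)
      simp only [hAa]
      ring
    rw [h1, P m n, P m' n', ← mul_sub, ← integral_sub (hD m n) (hD m' n')]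
  refine ⟨?_, ?_, ?_⟩
  · rw [hsplit 0 1 2 3 0 (fun y k => (hA y k).1)]
    rw [integral_congr_ae (g := fun y => -(η y * (A 1 y 0 * A 2 y 1 - A 2 y 0 * A 1 y 1)))
      (hMC.mono fun y hy => by simp only; rw [← mul_sub]; exact hy.1), integral_neg]
    ring
  · rw [hsplit 0 2 3 1 1 (fun y k => (hA y k).2.1)]
    rw [integral_congr_ae (g := fun y => -(η y * (A 2 y 0 * A 0 y 1 - A 0 y 0 * A 2 y 1)))
      (hMC.mono fun y hy => by simp only; rw [← mul_sub]; exact hy.2.1), integral_neg]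
    ring
  · rw [hsplit 0 3 1 2 2 (fun y k => (hA y k).2.2)]
    rw [integral_congr_ae (g := fun y => -(η y * (A 0 y 0 * A 1 y 1 - A 1 y 0 * A 0 y 1)))
      (hMC.mono fun y hy => by simp only; rw [← mul_sub]; exact hy.2.2), integral_neg]
    ring

/-! ## §7 (Q4) The H-system rows for the planar stream functions -/

/-- ★★★ **(Q4) THE STREAM FUNCTIONS OF THE LEFT CURRENTS SOLVE THE H-SYSTEM `ΔB = 2 B_x ∧ B_y` WEAKLY.**  If
`GB : ℝ² → (ℝ² →L ℝ³)` has columns `GB e₀ = (−A^a₁)_a`, `GB e₁ = (A^a₀)_a` (planar stream functions of the three left currents,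
brick (H)), then for every test function `η` and every `a : Fin 3`:
`−∫ Σ_k ∂_kη (GB e_k)_a = 2 ∫ η ((GB e₀)_{a+1} (GB e₁)_{a+2} − (GB e₀)_{a+2} (GB e₁)_{a+1})` — the hypothesis row of the named
fact `HSystemEnergyQuantization` [BrezisCoron1985, Lemma A.1, (A.1)] token for token. [cite: BrezisCoron1985, Appendix, Lemma A.1] -/
theorem hSystem_rows (hw : HasWeakFDerivOn ⟨Set.univ, isOpen_univ⟩ volume w Gw) (hw1 : ∀ y, ‖w y‖ = 1)
    (hE : Integrable (fun y => ∑ k : Fin 2, ‖Gw y (EuclideanSpace.single k (1:ℝ))‖ ^ 2) volume)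
    {J : Fin 4 → Fin 4 → EuclideanSpace ℝ (Fin 2) → Fin 2 → ℝ}
    (hJ : ∀ m n y k, J m n y k = w y m * Gw y (EuclideanSpace.single k (1:ℝ)) n - w y n * Gw y (EuclideanSpace.single k (1:ℝ)) m)
    {A : Fin 3 → EuclideanSpace ℝ (Fin 2) → Fin 2 → ℝ}
    (hA : ∀ y k, A 0 y k = J 0 1 y k - J 2 3 y k ∧ A 1 y k = J 0 2 y k - J 3 1 y k ∧ A 2 y k = J 0 3 y k - J 1 2 y k)
    {GB : EuclideanSpace ℝ (Fin 2) → EuclideanSpace ℝ (Fin 2) →L[ℝ] EuclideanSpace ℝ (Fin 3)}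
    (hGB : ∀ y a, GB y (EuclideanSpace.single 0 (1:ℝ)) a = -A a y 1 ∧ GB y (EuclideanSpace.single 1 (1:ℝ)) a = A a y 0)
    (η : EuclideanSpace ℝ (Fin 2) → ℝ) (hη : ContDiff ℝ ∞ η) (hηc : HasCompactSupport η) (a : Fin 3) :
    -(∫ y, ∑ k : Fin 2, fderiv ℝ η y (EuclideanSpace.single k (1:ℝ)) * (GB y (EuclideanSpace.single k (1:ℝ))) a) =
      2 * ∫ y, η y * ((GB y (EuclideanSpace.single 0 (1:ℝ))) (a + 1) * (GB y (EuclideanSpace.single 1 (1:ℝ))) (a + 2) -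
        (GB y (EuclideanSpace.single 0 (1:ℝ))) (a + 2) * (GB y (EuclideanSpace.single 1 (1:ℝ))) (a + 1)) := by
  obtain ⟨F0, F1, F2⟩ := leftCurrents_flat hw hw1 hE hJ hA hη hηc
  have hL : ∀ b : Fin 3, -(∫ y, ∑ k : Fin 2, fderiv ℝ η y (EuclideanSpace.single k (1:ℝ)) * (GB y (EuclideanSpace.single k (1:ℝ))) b) =
      ∫ y, (A b y 1 * fderiv ℝ η y (EuclideanSpace.single 0 (1:ℝ)) - A b y 0 * fderiv ℝ η y (EuclideanSpace.single 1 (1:ℝ))) := by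
    intro b
    rw [← integral_neg]
    refine integral_congr_ae (Filter.Eventually.of_forall fun y => ?_)
    simp only [Fin.sum_univ_two, (hGB y b).1, (hGB y b).2]
    ring
  have e01 : ((0 : Fin 3) + 1) = 1 := by decide
  have e02 : ((0 : Fin 3) + 2) = 2 := by decide
  have e11 : ((1 : Fin 3) + 1) = 2 := by decide
  have e12 : ((1 : Fin 3) + 2) = 0 := by decide
  have e21 : ((2 : Fin 3) + 1) = 0 := by decide
  have e22 : ((2 : Fin 3) + 2) = 1 := by decide
  rw [hL a]
  fin_cases a
  · simp only [Fin.zero_eta, e01, e02] at F0 ⊢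
    rw [F0]
    congr 1
    refine integral_congr_ae (Filter.Eventually.of_forall fun y => ?_)
    simp only [(hGB y 1).1, (hGB y 1).2, (hGB y 2).1, (hGB y 2).2]
    ring
  · simp only [Fin.mk_one, e11, e12] at F1 ⊢
    rw [F1]
    congr 1
    refine integral_congr_ae (Filter.Eventually.of_forall fun y => ?_)
    simp only [(hGB y 2).1, (hGB y 2).2, (hGB y 0).1, (hGB y 0).2]
    ring
  · simp only [Fin.reduceFinMk, e21, e22] at F2 ⊢
    rw [F2]
    congr 1
    refine integral_congr_ae (Filter.Eventually.of_forall fun y => ?_)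
    simp only [(hGB y 0).1, (hGB y 0).2, (hGB y 1).1, (hGB y 1).2]
    ring

/-- ★★ **(Q4′) THE ENERGY OF THE STREAM FUNCTIONS IS THE DIRICHLET ENERGY OF `w`**: with `GB` as in ✓`hSystem_rows`,
`Σ_k ‖GB e_k‖² = Σ_k ‖Gw e_k‖²` a.e., hence `∫ Σ_k ‖GB e_k‖² = ∫ |∇w|²` and the left side is integrable. [folklore] -/
theorem streamFunctions_energy (hw : HasWeakFDerivOn ⟨Set.univ, isOpen_univ⟩ volume w Gw) (hw1 : ∀ y, ‖w y‖ = 1)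
    (hE : Integrable (fun y => ∑ k : Fin 2, ‖Gw y (EuclideanSpace.single k (1:ℝ))‖ ^ 2) volume)
    {J : Fin 4 → Fin 4 → EuclideanSpace ℝ (Fin 2) → Fin 2 → ℝ}
    (hJ : ∀ m n y k, J m n y k = w y m * Gw y (EuclideanSpace.single k (1:ℝ)) n - w y n * Gw y (EuclideanSpace.single k (1:ℝ)) m)
    {A : Fin 3 → EuclideanSpace ℝ (Fin 2) → Fin 2 → ℝ}
    (hA : ∀ y k, A 0 y k = J 0 1 y k - J 2 3 y k ∧ A 1 y k = J 0 2 y k - J 3 1 y k ∧ A 2 y k = J 0 3 y k - J 1 2 y k)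
    {GB : EuclideanSpace ℝ (Fin 2) → EuclideanSpace ℝ (Fin 2) →L[ℝ] EuclideanSpace ℝ (Fin 3)}
    (hGB : ∀ y a, GB y (EuclideanSpace.single 0 (1:ℝ)) a = -A a y 1 ∧ GB y (EuclideanSpace.single 1 (1:ℝ)) a = A a y 0) :
    (∀ᵐ y, ∑ k : Fin 2, ‖GB y (EuclideanSpace.single k (1:ℝ))‖ ^ 2 = ∑ k : Fin 2, ‖Gw y (EuclideanSpace.single k (1:ℝ))‖ ^ 2) ∧
      Integrable (fun y => ∑ k : Fin 2, ‖GB y (EuclideanSpace.single k (1:ℝ))‖ ^ 2) volume ∧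
      ∫ y, ∑ k : Fin 2, ‖GB y (EuclideanSpace.single k (1:ℝ))‖ ^ 2 = ∫ y, ∑ k : Fin 2, ‖Gw y (EuclideanSpace.single k (1:ℝ))‖ ^ 2 := by
  have hae : ∀ᵐ y, ∑ k : Fin 2, ‖GB y (EuclideanSpace.single k (1:ℝ))‖ ^ 2 =
      ∑ k : Fin 2, ‖Gw y (EuclideanSpace.single k (1:ℝ))‖ ^ 2 := by
    have h3 : ∀ v : EuclideanSpace ℝ (Fin 3), ‖v‖ ^ 2 = v 0 ^ 2 + v 1 ^ 2 + v 2 ^ 2 := fun v => by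
      rw [EuclideanSpace.norm_sq_eq]
      simp [Fin.sum_univ_three, Real.norm_eq_abs, sq_abs]
    filter_upwards [leftCurrents_energy_ae hw hw1 hJ hA] with y hy
    rw [← hy]
    simp only [Fin.sum_univ_two, Fin.sum_univ_three, h3,
      (hGB y 0).1, (hGB y 0).2, (hGB y 1).1, (hGB y 1).2, (hGB y 2).1, (hGB y 2).2]
    ring
  exact ⟨hae, hE.congr (hae.mono fun y hy => hy.symm), integral_congr_ae hae⟩

end Plane

end Summit.QuantumFields.YangMills.Theorems.PoincareLipschitzQuaternionCurrentsHSystem
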